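import Summits.ResolutionOfSingularities.ResolutionOfSingularities.Theorems.EquisingularLiftEquisingularLiftNatInCarrierE1
import HarnessLib

/-!
# [OURS · L1 W4.5(b) · EL♮] T-E1-CONE-d: clause (e) for the exceptional CURVE of a doubled cone of degree `d`
# (`F ≡ u·Φ(c)²`), ring core + stalk assembly

Crux `EquisingularLiftNat` = stmt-ResolutionOfSingularities-20038 (route `EquisingularLift`, chain w45b), line `sections`, stub
`stub_elnat_three_isolated_nonabs` (child EL♮(3) stmt-ResolutionOfSingularities-20148); helper `--supports … --as helper` by
res-L1-w45b-stub-1 (own-lineage sequel of T-E1-CONE p510548 / p511213 / p512010, 2026-08-27). OURS; replaces the role of NOTHING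
in H. Hironaka's manuscript and is NOT a statement of it; AI-written kernel lemma, weaker than expert review.

T-E1-CONE (`…NatDoubledConeSaturation`, `…NatInCarrierE1`) proved clause (e) of a HorizChainE1 step for an in-carrier centre whose
trace is the exceptional LINE of a doubled PLANE (`F ≡ u·c_{j₀}²`; the quartic `x₀²x₃² + x₁⁴ + x₂⁴`). Here the plane `c_{j₀}`
is replaced by an arbitrary FORM `Φ(c)` of degree `d` in the generators of the centre: tangent cone of the running strict transform
at `s₀` = the DOUBLED CONE `u·Φ²` (e.g. `H_F`: `F₁₄ = F₇²`, `Φ = F₇`, `d = 7`; S-F; every first Δ-step of the isolated game,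
whose centre `C_Δ = V(t, Φ̃ + ϖh)` has special fibre the curve `V(Φ̄) ⊂ E_{s₀} ≅ ℙ²_k`). With res-type-100's chart form
`Φ(c/cᵢ) = MvPolynomial.aeval (blowupAlgebra.frac c i) Φ` (`…NatConeChart`, p508912):

* `exists_controlledTransform_doubledCone` — on `R[I/cᵢ]`: `F = cᵢ^{2d}·F′` with `F′ − u·Φ(c/cᵢ)² ∈ (cᵢ)`
  (`Φ(c) = cᵢ^d Φ(c/cᵢ)`, `algebraMap_eval_eq_pow_mul_coneTransform`);
* `controlledTransform_doubledCone_le` — `(F′) ≤ (Φ(c/cᵢ), cᵢ)`: the controlled transform contains the cone's exceptional curve;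
* `saturation_le_coneCurve_of_doubledCone` — DOWNSTAIRS (no `ϖ`): `c` quasi-regular, `R/I` a domain, `ū ≠ 0`, `Φ̄ᵢ ≠ 0` ⇒
  the `cᵢ`-saturation of `(F)·R[I/cᵢ]` is `≤ (Φ(c/cᵢ), cᵢ)` (it equals `(F′)`, `cᵢ` being a non-zero-divisor modulo `F′`
  because `F̄′ = ū·Φ̄ᵢ² ≠ 0` in the domain `R[I/cᵢ]/(cᵢ) ≅ (R/I)[T]` — the H-CONE argument p499011 for degree `d`);
* `saturation_le_coneCurve_of_doubledCone_mod` — UPSTAIRS (`ϖ`-lifted as in p510548): `F − u·Φ(c)² ∈ I^{2d+1} + ϖR` ⇒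
  `sat_{cᵢ}((ϖ, F)·R[I/cᵢ]) ≤ (Φ(c/cᵢ), cᵢ, ϖ)`;
* **`mem_strictTransformSet_of_doubledCone`** — the stalk assembly (`mem_strictTransformSet_of_saturation_le`, p512010): a point
  `x'` over `s₀`, read through a dictionary `(i, 𝔔, χ, e)` (p506193), with `Φ(c/cᵢ) ∈ 𝔔`, `cᵢ ∈ 𝔔`, `ϖ ∈ 𝔔` (a special-fibre point
  of the cone's exceptional curve) lies on `closure τ⁻¹(supp K ∖ supp J)` — clause (e).
References: Görtz–Wedhorn (13.19), Prop. 13.96 (2); The Stacks Project, Tags 0804, 0BIQ.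
-/

set_option linter.dupNamespace false -- mandated namespace `Summit.<Summit>.<Problem>` of this single-conjunct summit

noncomputable section

open CategoryTheory AlgebraicGeometry TopologicalSpace IsLocalRing IsLocalization
open Literature.AlgebraicGeometry.Resolution

namespace Summit.ResolutionOfSingularities.ResolutionOfSingularities.Cruxes.EquisingularLiftNat.Sections

universe u

section Ring

variable {R : Type u} [CommRing R] {r : ℕ} (c : Fin r → R) (i : Fin r)

/-- **The controlled transform of a doubled cone.** If `F - u·Φ(c)² ∈ I^{2d+1}` (`I = (c)`, `Φ` a form of degree `d`), then on
`R[I/cᵢ]`: `F = cᵢ^{2d}·F′` with `F′ - u·Φ(c/cᵢ)² ∈ (cᵢ)` (namely `F′ = u Φ(c/cᵢ)² + cᵢ·((F - uΦ²)/cᵢ^{2d+1})`). [folklore] -/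
theorem exists_controlledTransform_doubledCone {d : ℕ} {Φ : MvPolynomial (Fin r) R} (hΦd : Φ.IsHomogeneous d) {u F : R}
    (hF : F - u * MvPolynomial.eval c Φ ^ 2 ∈ Ideal.span (Set.range c) ^ (2 * d + 1)) :
    ∃ F' : blowupAlgebra (Ideal.span (Set.range c)) (c i),
      algebraMap R (blowupAlgebra (Ideal.span (Set.range c)) (c i)) F =
        algebraMap R (blowupAlgebra (Ideal.span (Set.range c)) (c i)) (c i) ^ (2 * d) * F' ∧
      F' - algebraMap R (blowupAlgebra (Ideal.span (Set.range c)) (c i)) u *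
        MvPolynomial.aeval (blowupAlgebra.frac c i) Φ ^ 2 ∈
        Ideal.span {algebraMap R (blowupAlgebra (Ideal.span (Set.range c)) (c i)) (c i)} := by
  -- `g := (F - u Φ²)/cᵢ^{2d+1} ∈ R[I/cᵢ]`
  let g : blowupAlgebra (Ideal.span (Set.range c)) (c i) :=
    ⟨algebraMap R (Localization.Away (c i)) (F - u * MvPolynomial.eval c Φ ^ 2) * Away.invSelf (c i) ^ (2 * d + 1),
      algebraMap_mul_invSelf_pow_mem_blowupAlgebra (I := Ideal.span (Set.range c)) (a := c i) (2 * d + 1) hF⟩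
  have hg : algebraMap R (blowupAlgebra (Ideal.span (Set.range c)) (c i)) (c i) ^ (2 * d + 1) * g =
      algebraMap R (blowupAlgebra (Ideal.span (Set.range c)) (c i)) (F - u * MvPolynomial.eval c Φ ^ 2) := by
    apply Subtype.ext
    change algebraMap R (Localization.Away (c i)) (c i) ^ (2 * d + 1) *
        (algebraMap R (Localization.Away (c i)) (F - u * MvPolynomial.eval c Φ ^ 2) * Away.invSelf (c i) ^ (2 * d + 1)) =
      algebraMap R (Localization.Away (c i)) (F - u * MvPolynomial.eval c Φ ^ 2)
    have hb : algebraMap R (Localization.Away (c i)) (c i) * Away.invSelf (c i) = 1 := Away.mul_invSelf (c i)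
    calc _ = (algebraMap R (Localization.Away (c i)) (c i) * Away.invSelf (c i)) ^ (2 * d + 1) *
          algebraMap R (Localization.Away (c i)) (F - u * MvPolynomial.eval c Φ ^ 2) := by ring
      _ = _ := by rw [hb, one_pow, one_mul]
  refine ⟨algebraMap R _ u * MvPolynomial.aeval (blowupAlgebra.frac c i) Φ ^ 2 +
      algebraMap R (blowupAlgebra (Ideal.span (Set.range c)) (c i)) (c i) * g, ?_, ?_⟩
  · have hF' : algebraMap R (blowupAlgebra (Ideal.span (Set.range c)) (c i)) F =
        algebraMap R _ u * algebraMap R _ (MvPolynomial.eval c Φ) ^ 2 +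
          algebraMap R (blowupAlgebra (Ideal.span (Set.range c)) (c i)) (c i) ^ (2 * d + 1) * g := by
      rw [hg, map_sub, map_mul, map_pow, add_sub_cancel]
    rw [hF', algebraMap_eval_eq_pow_mul_coneTransform c i hΦd]
    ring
  · rw [add_sub_cancel_left]
    exact Ideal.mul_mem_right _ _ (Ideal.mem_span_singleton_self _)

/-- Every controlled transform `F′` (`F = cᵢ^{2d} F′`) of a doubled cone satisfies `F′ - u Φ(c/cᵢ)² ∈ (cᵢ)` (`cᵢ` is a
non-zero-divisor of `R[I/cᵢ]`). [folklore] -/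
theorem controlledTransform_doubledCone_sub_mem {d : ℕ} {Φ : MvPolynomial (Fin r) R} (hΦd : Φ.IsHomogeneous d) {u F : R}
    (hF : F - u * MvPolynomial.eval c Φ ^ 2 ∈ Ideal.span (Set.range c) ^ (2 * d + 1))
    {F' : blowupAlgebra (Ideal.span (Set.range c)) (c i)}
    (hF' : algebraMap R (blowupAlgebra (Ideal.span (Set.range c)) (c i)) F =
      algebraMap R (blowupAlgebra (Ideal.span (Set.range c)) (c i)) (c i) ^ (2 * d) * F') :
    F' - algebraMap R (blowupAlgebra (Ideal.span (Set.range c)) (c i)) u *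
        MvPolynomial.aeval (blowupAlgebra.frac c i) Φ ^ 2 ∈
      Ideal.span {algebraMap R (blowupAlgebra (Ideal.span (Set.range c)) (c i)) (c i)} := by
  obtain ⟨F'', hF'', hmem⟩ := exists_controlledTransform_doubledCone c i hΦd hF
  rwa [controlledTransform_unique (Ideal.span (Set.range c)) (c i) hF' hF'']

/-- `(F′) ≤ (Φ(c/cᵢ), cᵢ)`: the controlled transform of the surface contains the cone's exceptional curve `V(cᵢ, Φ(c/cᵢ))` on the
chart. [folklore] -/
theorem controlledTransform_doubledCone_le {d : ℕ} {Φ : MvPolynomial (Fin r) R} (hΦd : Φ.IsHomogeneous d) {u F : R}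
    (hF : F - u * MvPolynomial.eval c Φ ^ 2 ∈ Ideal.span (Set.range c) ^ (2 * d + 1))
    {F' : blowupAlgebra (Ideal.span (Set.range c)) (c i)}
    (hF' : algebraMap R (blowupAlgebra (Ideal.span (Set.range c)) (c i)) F =
      algebraMap R (blowupAlgebra (Ideal.span (Set.range c)) (c i)) (c i) ^ (2 * d) * F') :
    Ideal.span {F'} ≤ Ideal.span {MvPolynomial.aeval (blowupAlgebra.frac c i) Φ,
      algebraMap R (blowupAlgebra (Ideal.span (Set.range c)) (c i)) (c i)} := by
  rw [Ideal.span_singleton_le_iff_mem]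
  have h := controlledTransform_doubledCone_sub_mem c i hΦd hF hF'
  have hsplit : F' = algebraMap R (blowupAlgebra (Ideal.span (Set.range c)) (c i)) u *
      MvPolynomial.aeval (blowupAlgebra.frac c i) Φ ^ 2 +
      (F' - algebraMap R (blowupAlgebra (Ideal.span (Set.range c)) (c i)) u *
        MvPolynomial.aeval (blowupAlgebra.frac c i) Φ ^ 2) := by ring
  rw [hsplit]
  refine Ideal.add_mem _ ?_
    (Ideal.span_mono (Set.singleton_subset_iff.mpr (Set.mem_insert_of_mem _ (Set.mem_singleton _))) h)
  rw [pow_two, ← mul_assoc]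
  exact Ideal.mul_mem_left _ _ (Ideal.subset_span (Set.mem_insert _ _))

/-- **DOWNSTAIRS: the strict transform of a doubled cone contains the cone's exceptional curve.** `c` quasi-regular with `R/I` a
domain, `Φ` a form of degree `d` with `Φ̄ᵢ ≠ 0` (non-zero reduced dehomogenisation), `ū ≠ 0`, `F - u·Φ(c)² ∈ I^{2d+1}`: every `g`
with `cᵢᴺ g ∈ (F)·R[I/cᵢ]` lies in `(Φ(c/cᵢ), cᵢ)` — indeed the saturation is `(F′)` since `F̄′ = ū Φ̄ᵢ² ≠ 0` in the domain
`R[I/cᵢ]/(cᵢ) ≅ (R/I)[T]` makes `cᵢ` a non-zero-divisor modulo `F′`. [folklore; H-CONE p499011 in degree `d`] -/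
theorem saturation_le_coneCurve_of_doubledCone (hc : IsQuasiRegular c) [IsDomain (R ⧸ Ideal.span (Set.range c))]
    {d : ℕ} {Φ : MvPolynomial (Fin r) R} (hΦd : Φ.IsHomogeneous d)
    (hΦ : MvPolynomial.map (Ideal.Quotient.mk (Ideal.span (Set.range c))) (dehomogenize i Φ) ≠ 0)
    {u F : R} (hu : u ∉ Ideal.span (Set.range c))
    (hF : F - u * MvPolynomial.eval c Φ ^ 2 ∈ Ideal.span (Set.range c) ^ (2 * d + 1))
    {g : blowupAlgebra (Ideal.span (Set.range c)) (c i)} {N : ℕ}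
    (hg : algebraMap R (blowupAlgebra (Ideal.span (Set.range c)) (c i)) (c i) ^ N * g ∈
      (Ideal.span {F}).map (algebraMap R (blowupAlgebra (Ideal.span (Set.range c)) (c i)))) :
    g ∈ Ideal.span {MvPolynomial.aeval (blowupAlgebra.frac c i) Φ,
      algebraMap R (blowupAlgebra (Ideal.span (Set.range c)) (c i)) (c i)} := by
  obtain ⟨F', hF', hsub⟩ := exists_controlledTransform_doubledCone c i hΦd hF
  refine controlledTransform_doubledCone_le c i hΦd hF hF' ?_
  -- `R[I/cᵢ]/(cᵢ)` is a domain and `F̄′ = ū Φ̄ᵢ² ≠ 0`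
  haveI : IsDomain (blowupAlgebra (Ideal.span (Set.range c)) (c i) ⧸
      Ideal.span {algebraMap R (blowupAlgebra (Ideal.span (Set.range c)) (c i)) (c i)}) :=
    MulEquiv.isDomain (MvPolynomial {j : Fin r // j ≠ i} (R ⧸ Ideal.span (Set.range c)))
      (blowupAlgebraQuotEquiv c i hc).symm.toMulEquiv
  have hF'ne : Ideal.Quotient.mk
      (Ideal.span {algebraMap R (blowupAlgebra (Ideal.span (Set.range c)) (c i)) (c i)}) F' ≠ 0 := by
    have h1 : Ideal.Quotient.mk (Ideal.span {algebraMap R (blowupAlgebra (Ideal.span (Set.range c)) (c i)) (c i)}) F' =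
        Ideal.Quotient.mk _ (algebraMap R (blowupAlgebra (Ideal.span (Set.range c)) (c i)) u *
          MvPolynomial.aeval (blowupAlgebra.frac c i) Φ ^ 2) := by
      rw [Ideal.Quotient.mk_eq_mk_iff_sub_mem]
      exact hsub
    rw [h1, map_mul, map_pow, mk_coneTransform_eq c i hc]
    refine mul_ne_zero ?_ (pow_ne_zero 2 fun h => hΦ ((blowupAlgebraQuotEquiv c i hc).injective (h.trans (map_zero _).symm)))
    -- `ū ≠ 0` in `(R/I)[T]`: `u/1 mod cᵢ = C ū`
    rw [← blowupAlgebraQuotEquiv_C c i hc, Ne, EmbeddingLike.map_eq_zero_iff, MvPolynomial.C_eq_zero,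
      Ideal.Quotient.eq_zero_iff_mem]
    exact hu
  -- `cᵢ` is a non-zero-divisor modulo `F′`
  have hreg : ∀ y, algebraMap R (blowupAlgebra (Ideal.span (Set.range c)) (c i)) (c i) * y ∈ Ideal.span {F'} →
      y ∈ Ideal.span {F'} := fun y hy =>
    mem_span_singleton_of_mul_mem_of_swap
      (algebraMap_mem_nonZeroDivisors_blowupAlgebra (I := Ideal.span (Set.range c)) (a := c i))
      (mem_span_singleton_of_mul_mem_of_isDomain hF'ne) hy
  -- from `cᵢᴺ g ∈ (F) = (cᵢ^{2d} F′) ⊆ (F′)` to `g ∈ (F′)`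
  rw [Ideal.map_span, Set.image_singleton, hF'] at hg
  have hg' : algebraMap R (blowupAlgebra (Ideal.span (Set.range c)) (c i)) (c i) ^ N * g ∈ Ideal.span {F'} := by
    obtain ⟨a, ha⟩ := Ideal.mem_span_singleton'.mp hg
    exact Ideal.mem_span_singleton'.mpr
      ⟨a * algebraMap R (blowupAlgebra (Ideal.span (Set.range c)) (c i)) (c i) ^ (2 * d), by rw [← ha]; ring⟩
  clear hg
  induction N generalizing g with
  | zero => simpa using hg'
  | succ n ih =>
    rw [pow_succ', mul_assoc] at hg'
    exact ih (hreg _ hg')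

/-- **UPSTAIRS (modulo the uniformizer)**: with `ϖ ∉ I`, `c̄ = c mod ϖ` quasi-regular, `(R/ϖ)/(c̄)` a domain, `ū ∉ (c̄)`, `Φ̄ᵢ ≠ 0`
over `(R/ϖ)/(c̄)`, and `F - u·Φ(c)² ∈ I^{2d+1} + ϖR`: the `cᵢ`-saturation of `(ϖ, F)·R[I/cᵢ]` lies in `(Φ(c/cᵢ), cᵢ, ϖ)`.
[folklore; the `ϖ`-lift of p510548 in degree `d`] -/
theorem saturation_le_coneCurve_of_doubledCone_mod (hc : IsQuasiRegular c) [IsDomain (R ⧸ Ideal.span (Set.range c))]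
    {ϖ : R} (hϖ : ϖ ∉ Ideal.span (Set.range c))
    (hcbar : IsQuasiRegular fun l => Ideal.Quotient.mk (Ideal.span {ϖ}) (c l))
    [IsDomain ((R ⧸ Ideal.span {ϖ}) ⧸ Ideal.span (Set.range fun l => Ideal.Quotient.mk (Ideal.span {ϖ}) (c l)))]
    {d : ℕ} {Φ : MvPolynomial (Fin r) R} (hΦd : Φ.IsHomogeneous d)
    (hΦ : MvPolynomial.map (Ideal.Quotient.mk (Ideal.span (Set.range fun l => Ideal.Quotient.mk (Ideal.span {ϖ}) (c l))))
      (dehomogenize i (MvPolynomial.map (Ideal.Quotient.mk (Ideal.span {ϖ})) Φ)) ≠ 0)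
    {u F : R} (hu : Ideal.Quotient.mk (Ideal.span {ϖ}) u ∉
      Ideal.span (Set.range fun l => Ideal.Quotient.mk (Ideal.span {ϖ}) (c l)))
    (hF : F - u * MvPolynomial.eval c Φ ^ 2 ∈ Ideal.span (Set.range c) ^ (2 * d + 1) ⊔ Ideal.span {ϖ})
    {g : blowupAlgebra (Ideal.span (Set.range c)) (c i)} {N : ℕ}
    (hg : algebraMap R (blowupAlgebra (Ideal.span (Set.range c)) (c i)) (c i) ^ N * g ∈
      (Ideal.span {ϖ, F}).map (algebraMap R (blowupAlgebra (Ideal.span (Set.range c)) (c i)))) :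
    g ∈ Ideal.span {MvPolynomial.aeval (blowupAlgebra.frac c i) Φ,
      algebraMap R (blowupAlgebra (Ideal.span (Set.range c)) (c i)) (c i),
      algebraMap R (blowupAlgebra (Ideal.span (Set.range c)) (c i)) ϖ} := by
  -- the reduction map `θ : R[I/cᵢ] → R̄[Ī/c̄ᵢ]` along `q : R → R/ϖ` (as in p510548)
  have hIJ' : (Ideal.span (Set.range c)).map (Ideal.Quotient.mk (Ideal.span {ϖ})) =
      Ideal.span (Set.range fun l => Ideal.Quotient.mk (Ideal.span {ϖ}) (c l)) := by
    rw [Ideal.map_span, ← Set.range_comp]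
    rfl
  have hIJ := hIJ'.le
  have hθsurj : Function.Surjective (blowupAlgebraMap (Ideal.Quotient.mk (Ideal.span {ϖ})) (Ideal.span (Set.range c))
      (Ideal.span (Set.range fun l => Ideal.Quotient.mk (Ideal.span {ϖ}) (c l))) (c i) hIJ) :=
    blowupAlgebraMap_surjective _ _ _ _ Ideal.Quotient.mk_surjective hIJ hIJ'.ge
  have hθa : ∀ a : R, blowupAlgebraMap (Ideal.Quotient.mk (Ideal.span {ϖ})) (Ideal.span (Set.range c))
      (Ideal.span (Set.range fun l => Ideal.Quotient.mk (Ideal.span {ϖ}) (c l))) (c i) hIJ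
        (algebraMap R (blowupAlgebra (Ideal.span (Set.range c)) (c i)) a) =
      algebraMap _ _ (Ideal.Quotient.mk (Ideal.span {ϖ}) a) := fun a => blowupAlgebraMap_algebraMap _ _ _ _ hIJ a
  have hθfrac : ∀ j, blowupAlgebraMap (Ideal.Quotient.mk (Ideal.span {ϖ})) (Ideal.span (Set.range c))
      (Ideal.span (Set.range fun l => Ideal.Quotient.mk (Ideal.span {ϖ}) (c l))) (c i) hIJ (blowupAlgebra.frac c i j) =
      blowupAlgebra.frac (fun l => Ideal.Quotient.mk (Ideal.span {ϖ}) (c l)) i j := fun j => by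
    rw [blowupAlgebra.frac, blowupAlgebraMap_gen]
  -- `θ Φ(c/cᵢ) = Φ̄(c̄/c̄ᵢ)`
  have hθΦ : blowupAlgebraMap (Ideal.Quotient.mk (Ideal.span {ϖ})) (Ideal.span (Set.range c))
      (Ideal.span (Set.range fun l => Ideal.Quotient.mk (Ideal.span {ϖ}) (c l))) (c i) hIJ
        (MvPolynomial.aeval (blowupAlgebra.frac c i) Φ) =
      MvPolynomial.aeval (blowupAlgebra.frac (fun l => Ideal.Quotient.mk (Ideal.span {ϖ}) (c l)) i)
        (MvPolynomial.map (Ideal.Quotient.mk (Ideal.span {ϖ})) Φ) := by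
    rw [MvPolynomial.map_aeval, MvPolynomial.coe_eval₂Hom, MvPolynomial.aeval_def, MvPolynomial.eval₂_map]
    congr 1
    · exact RingHom.ext fun a => hθa a
    · exact funext fun j => hθfrac j
  -- downstairs hypothesis `F̄ - ū Φ̄(c̄)² ∈ Ī^{2d+1}`
  have hFbar : Ideal.Quotient.mk (Ideal.span {ϖ}) F - Ideal.Quotient.mk (Ideal.span {ϖ}) u *
      MvPolynomial.eval (fun l => Ideal.Quotient.mk (Ideal.span {ϖ}) (c l))
        (MvPolynomial.map (Ideal.Quotient.mk (Ideal.span {ϖ})) Φ) ^ 2 ∈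
      Ideal.span (Set.range fun l => Ideal.Quotient.mk (Ideal.span {ϖ}) (c l)) ^ (2 * d + 1) := by
    have h1 : Ideal.Quotient.mk (Ideal.span {ϖ}) (F - u * MvPolynomial.eval c Φ ^ 2) ∈
        (Ideal.span (Set.range c) ^ (2 * d + 1) ⊔ Ideal.span {ϖ}).map (Ideal.Quotient.mk (Ideal.span {ϖ})) :=
      Ideal.mem_map_of_mem _ hF
    rw [Ideal.map_sup, Ideal.map_pow, hIJ', Ideal.map_span, Set.image_singleton,
      Ideal.Quotient.eq_zero_iff_mem.mpr (Ideal.mem_span_singleton_self ϖ), Ideal.span_singleton_zero, sup_bot_eq,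
      map_sub, map_mul, map_pow, MvPolynomial.eval₂_comp] at h1
    rw [MvPolynomial.eval_map]
    exact h1
  -- `θ g` lies in the downstairs saturation, hence in `(Φ̄(c̄/c̄ᵢ), c̄ᵢ)`
  have hdown : blowupAlgebraMap (Ideal.Quotient.mk (Ideal.span {ϖ})) (Ideal.span (Set.range c))
      (Ideal.span (Set.range fun l => Ideal.Quotient.mk (Ideal.span {ϖ}) (c l))) (c i) hIJ g ∈
      Ideal.span {MvPolynomial.aeval (blowupAlgebra.frac (fun l => Ideal.Quotient.mk (Ideal.span {ϖ}) (c l)) i)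
        (MvPolynomial.map (Ideal.Quotient.mk (Ideal.span {ϖ})) Φ),
        algebraMap _ (blowupAlgebra (Ideal.span (Set.range fun l => Ideal.Quotient.mk (Ideal.span {ϖ}) (c l)))
          ((fun l => Ideal.Quotient.mk (Ideal.span {ϖ}) (c l)) i)) ((fun l => Ideal.Quotient.mk (Ideal.span {ϖ}) (c l)) i)} := by
    refine saturation_le_coneCurve_of_doubledCone (fun l => Ideal.Quotient.mk (Ideal.span {ϖ}) (c l)) i hcbar
      (hΦd.map _) hΦ hu hFbar (N := N) ?_
    have h1 := Ideal.mem_map_of_mem (blowupAlgebraMap (Ideal.Quotient.mk (Ideal.span {ϖ})) (Ideal.span (Set.range c))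
      (Ideal.span (Set.range fun l => Ideal.Quotient.mk (Ideal.span {ϖ}) (c l))) (c i) hIJ) hg
    rw [map_mul, map_pow, hθa, Ideal.map_map, Ideal.map_span] at h1
    rw [Ideal.map_span, Set.image_singleton]
    refine Ideal.span_le.mpr ?_ h1
    rintro _ ⟨a, ha, rfl⟩
    rcases ha with rfl | ha
    · rw [RingHom.comp_apply, hθa, Ideal.Quotient.eq_zero_iff_mem.mpr (Ideal.mem_span_singleton_self _), map_zero]
      exact zero_mem _
    · rw [Set.mem_singleton_iff.mp ha, RingHom.comp_apply, hθa]
      exact Ideal.mem_span_singleton_self _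
  -- lift along `θ`; `ker θ = ϖ·R[I/cᵢ]` (p510548)
  obtain ⟨a', b', hab⟩ := Ideal.mem_span_pair.mp hdown
  obtain ⟨a, rfl⟩ := hθsurj a'
  obtain ⟨b, rfl⟩ := hθsurj b'
  have hdiff : g - (a * MvPolynomial.aeval (blowupAlgebra.frac c i) Φ +
      b * algebraMap R (blowupAlgebra (Ideal.span (Set.range c)) (c i)) (c i)) ∈
      RingHom.ker (blowupAlgebraMap (Ideal.Quotient.mk (Ideal.span {ϖ})) (Ideal.span (Set.range c))
        (Ideal.span (Set.range fun l => Ideal.Quotient.mk (Ideal.span {ϖ}) (c l))) (c i) hIJ) := by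
    rw [RingHom.mem_ker, map_sub, map_add, map_mul, map_mul, hθΦ, hθa, hab, sub_self]
  rw [ker_blowupAlgebraMap_quotient_uniformizer c i hc hϖ _ hIJ, Ideal.map_span, Set.image_singleton] at hdiff
  have hsplit : g = (a * MvPolynomial.aeval (blowupAlgebra.frac c i) Φ +
      b * algebraMap R (blowupAlgebra (Ideal.span (Set.range c)) (c i)) (c i)) +
      (g - (a * MvPolynomial.aeval (blowupAlgebra.frac c i) Φ +
        b * algebraMap R (blowupAlgebra (Ideal.span (Set.range c)) (c i)) (c i))) := by ring
  rw [hsplit]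
  refine Ideal.add_mem _ (Ideal.add_mem _ ?_ ?_) ?_
  · exact Ideal.mul_mem_left _ _ (Ideal.subset_span (Set.mem_insert _ _))
  · exact Ideal.mul_mem_left _ _ (Ideal.subset_span (Set.mem_insert_of_mem _ (Set.mem_insert _ _)))
  · exact Ideal.span_mono (Set.singleton_subset_iff.mpr
      (Set.mem_insert_of_mem _ (Set.mem_insert_of_mem _ (Set.mem_singleton _)))) hdiff

end Ring

/-! ## Stalk assembly: clause (e) for the doubled cone -/

variable {X X' : Scheme.{u}} {τ : X' ⟶ X} {J : X.IdealSheafData}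

/-- **T-E1-CONE-d: clause (e) for the exceptional curve of a doubled cone of degree `d`.** As `mem_strictTransformSet_of_doubledPlaneCone`
(p512010) with the plane `c_{j₀}` replaced by a form `Φ(c)` of degree `d`: `K_{τ x'} = (ϖ, F)`, `F ≡ u·Φ(c)² (mod (c)^{2d+1} + ϖR)`,
and `x'` — read through a dictionary `(i, 𝔔, χ, e)` (p506193) — a special-fibre point of the cone's exceptional curve
(`Φ(c/cᵢ) ∈ 𝔔`, `cᵢ/1 ∈ 𝔔`, `ϖ/1 ∈ 𝔔`) ⇒ `x' ∈ closure τ⁻¹(supp K ∖ supp J)`. (E.g. `H_F`: `Φ = F₇`, the first Δ-step's trace.)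
[folklore; OURS assembly] -/
theorem mem_strictTransformSet_of_doubledCone [IsLocallyNoetherian X']
    (K : X.IdealSheafData) (x' : X') {r : ℕ} (c : Fin r → X.presheaf.stalk (τ x'))
    (hcJ : Ideal.span (Set.range c) = stalkIdeal J (τ x')) (hc : IsQuasiRegular c)
    [IsDomain (X.presheaf.stalk (τ x') ⧸ Ideal.span (Set.range c))]
    {ϖ F u : X.presheaf.stalk (τ x')} (hϖ : ϖ ∉ Ideal.span (Set.range c))
    (hcbar : IsQuasiRegular fun l => Ideal.Quotient.mk (Ideal.span {ϖ}) (c l))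
    [IsDomain ((X.presheaf.stalk (τ x') ⧸ Ideal.span {ϖ}) ⧸
      Ideal.span (Set.range fun l => Ideal.Quotient.mk (Ideal.span {ϖ}) (c l)))]
    (i : Fin r) {d : ℕ} {Φ : MvPolynomial (Fin r) (X.presheaf.stalk (τ x'))} (hΦd : Φ.IsHomogeneous d)
    (hΦ : MvPolynomial.map (Ideal.Quotient.mk (Ideal.span (Set.range fun l => Ideal.Quotient.mk (Ideal.span {ϖ}) (c l))))
      (dehomogenize i (MvPolynomial.map (Ideal.Quotient.mk (Ideal.span {ϖ})) Φ)) ≠ 0)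
    (hu : Ideal.Quotient.mk (Ideal.span {ϖ}) u ∉
      Ideal.span (Set.range fun l => Ideal.Quotient.mk (Ideal.span {ϖ}) (c l)))
    (hF : F - u * MvPolynomial.eval c Φ ^ 2 ∈ Ideal.span (Set.range c) ^ (2 * d + 1) ⊔ Ideal.span {ϖ})
    (hK : stalkIdeal K (τ x') = Ideal.span {ϖ, F})
    (𝔔 : PrimeSpectrum (blowupAlgebra (Ideal.span (Set.range c)) (c i)))
    (χ : blowupAlgebra (Ideal.span (Set.range c)) (c i) →+* X'.presheaf.stalk x')
    (e : X'.presheaf.stalk x' ≃+* Localization.AtPrime 𝔔.asIdeal)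
    (hχ : ∀ a, χ (algebraMap _ _ a) = (τ.stalkMap x').hom a)
    (he : ∀ b, e (χ b) = algebraMap _ (Localization.AtPrime 𝔔.asIdeal) b)
    (hΦQ : MvPolynomial.aeval (blowupAlgebra.frac c i) Φ ∈ 𝔔.asIdeal)
    (hci : algebraMap _ (blowupAlgebra (Ideal.span (Set.range c)) (c i)) (c i) ∈ 𝔔.asIdeal)
    (hϖQ : algebraMap _ (blowupAlgebra (Ideal.span (Set.range c)) (c i)) ϖ ∈ 𝔔.asIdeal) :
    x' ∈ closure (τ ⁻¹' ((K.support : Set X) \ (J.support : Set X))) := by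
  refine mem_strictTransformSet_of_saturation_le K x' c hcJ {ϖ, F} hK i 𝔔 χ e hχ he fun g N hg => ?_
  refine Ideal.span_le.mpr ?_ (saturation_le_coneCurve_of_doubledCone_mod c i hc hϖ hcbar hΦd hΦ hu hF hg)
  rintro _ (rfl | rfl | h)
  · exact hΦQ
  · exact hci
  · rw [Set.mem_singleton_iff.mp h]; exact hϖQ

end Summit.ResolutionOfSingularities.ResolutionOfSingularities.Cruxes.EquisingularLiftNat.Sections

end
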